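import Summits.CriticalPhenomena.SAWScalingLimit.Theorems.SAWLoopFugacityFlowAvoidanceLimitHarmonicExitRepresentation
import Summits.CriticalPhenomena.SAWScalingLimit.Theorems.SAWLoopFugacityFlowAvoidanceLimitInteriorRatioLimitSubharmonic
import Literature.Probability.LatticeModels.UniformBHPFromCrossRatio
import HarnessLib

/-!
# UBHP for the `Ω_δ`-walk from the germ-region cross-ratio bound (line `symplectic-fermion-anchor`,
crux `SAWLoopFugacityFlow.AvoidanceLimit`, stmt-CriticalPhenomena-10649; lead c5)

The uniform boundary Harnack principle `stub_uniformBHP` of the line (functions on the volume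
`Λ = meshDomainFinset D δ`, harmonicity `(¼·adjMat H Λ) h = h` for `H = discreteDomainGraph D δ`) is, up
to a dictionary, the conclusion of the tree's `Literature.Probability.LatticeModels.uniformBHP_of_crossRatio`
(Chelkak–Wan's iteration over the lattice GERM REGIONS `Θ_δ(s) = germSites D b s g o δ` of
`GermRegions` / `GermRegionLattice`, functions on `Site 2`, harmonicity through `killedAvg`). This file
proves the dictionary (`transition_mulVec_eq_killedAvg_dite`: the `P`-average of `h : Λ → ℝ` is the
killed average of its zero extension, because every `H`-neighbour of a vertex of `Λ` lies in `Λ`) and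
derives `UniformBHP` from the ONE remaining input of that file — the one-annulus cross-ratio bound for the
exit kernels `killedPoisson (Ω_δ) Θ_δ(s')` between the exits of `Θ_δ(s)` and of `Θ_δ(s')`, `s' = K s`
(`hcore`, Chelkak–Wan 2021 Prop. 3.6 / Chelkak 2016 §3 for the edge-killed walk) — so that the line's
skeleton and the Literature fact `KozdronLawler2005_martinRatioBoundaryLimit` rest on the SAME statement.

Sources: D. Chelkak, Y. Wan, EJP 26 (2021) §3.2 [ChelkakWan2021]; D. Chelkak, Ann. Probab. 44 (2016) §3
[Chelkak2016]. No definitions.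
-/

noncomputable section

open scoped BigOperators Topology Classical
open Filter Finset
open Literature.Probability.RandomPlanarGeometry Literature.Probability.LatticeModels
open Literature.Topology.PlaneTopology (closedBox boxJD TwoOff)

namespace Summit.CriticalPhenomena.SAWScalingLimit.Theorems.AvoidanceLimit.Anchor

/-- **Dictionary.** For `H ≤ ℤ²`, a volume `Λ` containing every `H`-neighbour of the vertex `x ∈ Λ`, and
`h : Λ → ℝ`: the `P`-average `((¼·adjMat H Λ) h)(x)` equals the killed average `killedAvg H h̃ x` of the
zero extension `h̃` of `h` off `Λ` (the walk on `ℤ²` killed at its first non-`H` step). [folklore] -/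
theorem transition_mulVec_eq_killedAvg_dite {H : SimpleGraph (Site 2)} (hH : H ≤ zdGraph 2)
    (Λ : Finset (Site 2)) (h : ↥Λ → ℝ) (x : ↥Λ) (hΛ : ∀ y : Site 2, H.Adj x y → y ∈ Λ) :
    Matrix.mulVec ((4 : ℝ)⁻¹ • adjMat H Λ) h x =
      killedAvg H (fun v => if hv : v ∈ Λ then h ⟨v, hv⟩ else 0) x := by
  set g : Site 2 → ℝ := fun v => if hv : v ∈ Λ then h ⟨v, hv⟩ else 0 with hg
  rw [transition_mulVec_eq_sum_filter_dite, killedAvg_def]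
  congr 1
  have h1 : (∑ e : SRW.Dir 2,
      (if H.Adj (x : Site 2) ((x : Site 2) + SRW.stepVec e) then g ((x : Site 2) + SRW.stepVec e) else 0)) =
      ∑ z ∈ (zdGraph 2).neighborFinset (x : Site 2), (if H.Adj (x : Site 2) z then g z else 0) := by
    have := sum_dir_eq_sum_cornerUnit
      (fun v => if H.Adj (x : Site 2) ((x : Site 2) + v) then g ((x : Site 2) + v) else 0)
    rw [this]
    exact sum_cornerUnit_eq_sum_neighborFinset (x : Site 2) (fun z => if H.Adj (x : Site 2) z then g z else 0)
  rw [h1, ← Finset.sum_filter]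
  refine Finset.sum_congr ?_ fun _ _ => rfl
  ext z
  simp only [Finset.mem_filter, SimpleGraph.mem_neighborFinset]
  constructor
  · rintro ⟨-, hz⟩
    exact ⟨hH hz, hz⟩
  · rintro ⟨-, hz⟩
    exact ⟨hΛ z hz, hz⟩

/-- **UBHP from the germ-region cross-ratio bound.** If, at every boundary point `b` of every Jordan
domain, the exit kernels of the lattice germ regions satisfy the one-annulus cross-ratio bound (the
hypothesis `hcore` of `uniformBHP_of_crossRatio`), then the uniform boundary Harnack principle
`UniformBHP` of the line holds: for a Dobrushin domain `D`, a marked point `p = D.pt i`, `R, η > 0` there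
is `r > 0` such that for all small `δ` any two nonnegative `h₁, h₂ : Λ → ℝ` that are `P`-harmonic within
`R` of `p` satisfy `h₁(z) h₂(z') ≤ (1+η) h₁(z') h₂(z)` within `r` of `p`. [cite: ChelkakWan2021, Corollary 3.8] -/
theorem uniformBHP_of_germCrossRatio :
    (∀ (D : JordanDomain), ∀ b ∈ frontier D.carrier, ∃ K C s₀ : ℝ, 1 < K ∧ 1 ≤ C ∧ 0 < s₀ ∧
      ∀ (s s' : ℝ) (hs : 0 < s) (hs' : 0 < s'), s' = K * s → s' < s₀ →
      ∀ (g o : ℂ), g ∈ D.carrier ∩ Literature.Topology.PlaneTopology.box b s → o ∈ D.carrier →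
      o ∉ closedBox b s' → TwoOff D (boxJD b hs) → TwoOff D (boxJD b hs') →
      ∀ᶠ δ in 𝓝[>] (0 : ℝ),
        ∀ u ∈ germExits D b hs g o δ, ∀ v ∈ germExits D b hs g o δ,
        ∀ x ∈ germExits D b hs' g o δ, ∀ y ∈ germExits D b hs' g o δ,
          killedPoisson (discreteDomainGraph D.carrier δ) (germSites D b hs' g o δ) u x *
              killedPoisson (discreteDomainGraph D.carrier δ) (germSites D b hs' g o δ) v y ≤
            C * (killedPoisson (discreteDomainGraph D.carrier δ) (germSites D b hs' g o δ) v x *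
              killedPoisson (discreteDomainGraph D.carrier δ) (germSites D b hs' g o δ) u y)) →
    ∀ (D : DobrushinDomain) (i : Fin 2) (R : ℝ), 0 < R → ∀ η : ℝ, 0 < η → ∃ r : ℝ, 0 < r ∧
      ∀ᶠ δ in 𝓝[>] (0 : ℝ), ∀ h₁ h₂ : ↥(meshDomainFinset D.carrier δ) → ℝ,
        (∀ x, 0 ≤ h₁ x) → (∀ x, 0 ≤ h₂ x) →
        (∀ x : ↥(meshDomainFinset D.carrier δ), dist (meshPoint δ x) (D.pt i) < R →
          Matrix.mulVec ((4 : ℝ)⁻¹ • adjMat (discreteDomainGraph D.carrier δ)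
            (meshDomainFinset D.carrier δ)) h₁ x = h₁ x) →
        (∀ x : ↥(meshDomainFinset D.carrier δ), dist (meshPoint δ x) (D.pt i) < R →
          Matrix.mulVec ((4 : ℝ)⁻¹ • adjMat (discreteDomainGraph D.carrier δ)
            (meshDomainFinset D.carrier δ)) h₂ x = h₂ x) →
        ∀ z z' : ↥(meshDomainFinset D.carrier δ), dist (meshPoint δ z) (D.pt i) < r →
          dist (meshPoint δ z') (D.pt i) < r → h₁ z * h₂ z' ≤ (1 + η) * (h₁ z' * h₂ z) := by
  intro hcore D i R hR η hη
  obtain ⟨r, hr, hev⟩ :=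
    uniformBHP_of_crossRatio hcore D.toJordanDomain (D.pt i) (D.pt_mem_frontier i) R hR η hη
  refine ⟨r, hr, ?_⟩
  have h0 : ∀ᶠ δ in 𝓝[>] (0 : ℝ), 0 < δ := eventually_mem_nhdsWithin
  filter_upwards [hev, h0] with δ hδ hδ0
  intro h₁ h₂ hpos₁ hpos₂ hharm₁ hharm₂ z z' hz hz'
  have hHzd : discreteDomainGraph D.carrier δ ≤ zdGraph 2 :=
    (discreteDomainGraph_le_meshGraph D.carrier δ).trans (meshGraph_le_zdGraph D.carrier δ)
  have hΛcoe : ((meshDomainFinset D.carrier δ : Finset (Site 2)) : Set (Site 2)) =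
      meshDomain D.carrier δ := coe_meshDomainFinset D.isBounded hδ0
  have hmemΛ : ∀ {v : Site 2}, v ∈ meshDomain D.carrier δ ↔ v ∈ meshDomainFinset D.carrier δ :=
    fun {v} => by rw [← Finset.mem_coe, hΛcoe]
  have hadjΛ : ∀ x y : Site 2, (discreteDomainGraph D.carrier δ).Adj x y →
      y ∈ meshDomainFinset D.carrier δ :=
    fun x y hxy => hmemΛ.1 (discreteDomainGraph_adj_iff.1 hxy).2.2
  -- zero extensions
  set g₁ : Site 2 → ℝ := fun v => if hv : v ∈ meshDomainFinset D.carrier δ then h₁ ⟨v, hv⟩ else 0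
    with hg₁
  set g₂ : Site 2 → ℝ := fun v => if hv : v ∈ meshDomainFinset D.carrier δ then h₂ ⟨v, hv⟩ else 0
    with hg₂
  have hg₁v : ∀ v : ↥(meshDomainFinset D.carrier δ), g₁ v = h₁ v := fun v => by
    simp [hg₁, v.2]
  have hg₂v : ∀ v : ↥(meshDomainFinset D.carrier δ), g₂ v = h₂ v := fun v => by
    simp [hg₂, v.2]
  have hg₁nn : ∀ v, 0 ≤ g₁ v := fun v => by
    by_cases hv : v ∈ meshDomainFinset D.carrier δ
    · rw [hg₁v ⟨v, hv⟩]; exact hpos₁ _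
    · simp [hg₁, hv]
  have hg₂nn : ∀ v, 0 ≤ g₂ v := fun v => by
    by_cases hv : v ∈ meshDomainFinset D.carrier δ
    · rw [hg₂v ⟨v, hv⟩]; exact hpos₂ _
    · simp [hg₂, hv]
  -- harmonicity in the `killedAvg` form
  have hharm : ∀ (h : ↥(meshDomainFinset D.carrier δ) → ℝ),
      (∀ x : ↥(meshDomainFinset D.carrier δ), dist (meshPoint δ x) (D.pt i) < R →
        Matrix.mulVec ((4 : ℝ)⁻¹ • adjMat (discreteDomainGraph D.carrier δ)
          (meshDomainFinset D.carrier δ)) h x = h x) →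
      ∀ v ∈ meshDomain D.carrier δ, dist (meshPoint δ v) (D.pt i) < R →
        (fun w => if hw : w ∈ meshDomainFinset D.carrier δ then h ⟨w, hw⟩ else 0) v =
          4⁻¹ * ∑ e : SRW.Dir 2,
            if (discreteDomainGraph D.carrier δ).Adj v (v + SRW.stepVec e) then
              (fun w => if hw : w ∈ meshDomainFinset D.carrier δ then h ⟨w, hw⟩ else 0) (v + SRW.stepVec e)
            else 0 := by
    intro h hh v hv hvR
    have hvΛ : v ∈ meshDomainFinset D.carrier δ := hmemΛ.1 hv
    have key := hh ⟨v, hvΛ⟩ hvR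
    rw [transition_mulVec_eq_killedAvg_dite hHzd _ h ⟨v, hvΛ⟩ (hadjΛ v), killedAvg_def] at key
    have hL : (fun w => if hw : w ∈ meshDomainFinset D.carrier δ then h ⟨w, hw⟩ else 0) v = h ⟨v, hvΛ⟩ := by
      simp [hvΛ]
    rw [hL, ← key]
  have key := hδ g₁ g₂ hg₁nn hg₂nn (hharm h₁ hharm₁) (hharm h₂ hharm₂) z z' (hmemΛ.2 z.2)
    (hmemΛ.2 z'.2) hz hz'
  rwa [hg₁v, hg₁v, hg₂v, hg₂v] at key

end Summit.CriticalPhenomena.SAWScalingLimit.Theorems.AvoidanceLimit.Anchor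

end
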